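/- Copyright: the b2b-balaban cell (near-miss cell 7), T⁴-continuum fan-out, ROUND-2 swarm of lineage t4-ne7b-p1
(node U5c COUNT member), seat t4-ne7b-formalise-leaf-04.  Released under the licence of the surrounding project. -/
import Summits.QuantumFields.BalabanUV.T4Continuum.Support.HistoryConstants

/-!
# History constants through the shape map: `Dominates` on TAGGED genealogies (the TH exit's price side)

Summits-side support leaf of the T⁴-continuum cell (rung (B)+1 on a FINITE torus only; NOT infinite volume, NOT the
mass gap, NOT the Clay statement; NOT a proof of the spine estimate NE7b).  Claim table
`t4/b2b-balaban-t4-ne7b-p1/LEAVES-NE7b.md` ∕ typer's mirror `t4/formal/NE7b/LEAVES.md` item F-S10-price-TH, the S9 half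
(cell journal «CLAIM NE7b-F-S10-price-TH», 2026-08-20): after the owner's ruling R-OWNER-22-1 the COUNT assembly targets
the TH exit `CountThresholdExit.relWeightBound_lateMergers_of_irThreshold` (tree count over TAGGED genealogies `Gen ε`
read through a shape map `sh : ε → PEv`; `D := 0`, `Δ := 1`), whose price binder `hlabTH` and the socket-v3 `price`
fields are written with the TAGGED tables of `Balaban1983to89.T4TaggedShapeBanking` — `credits (credit C g ∘ sh) G′`,
`lifeCost (padW (dictWT sh R C.n₁) D) (costT sh C K R) G′`, `partnerAges (PEv.step ∘ sh) G′`.  This leaf carries row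
S9's constants junction (`HistoryConstants.Dominates C O`: the model's credits entrywise BELOW print's, its cost tables
entrywise ABOVE print's) through `sh`.  [folklore] real arithmetic and finite sums∕products over the lineage's own
carrier; nothing printed is asserted (print's displayed shapes are those LOCATED in `HistoryConstants`); no
`Prop`-valued fact of Bałaban's is minted; no constant is specialised (trigger conditions c1∕c2∕c6).

WHAT.  §1 through the shape map: `Dominates.creditT_le`, **`Dominates.creditsT_le`** (`credits (credit C g ∘ sh) G′ ≤
credits (pcredit O C g ∘ sh) G′`, every tagged genealogy, every run), the entry dominations of `costT`'s summands at a
tagged event (`Dominates.floor_le_wfloorT` — print's floor below the model's window floor on the placed window at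
performed steps; the size∕connector entries are `HistoryConstants`' `size_le_sz`∕`connector_le_sz` read at `sh e`), and
`lifeCostT_mono` (any label type, ANY window table — so the padded table `padW (dictWT sh R C.n₁) D` of the TH exit is
covered).  §2 **`shapeTH`** := the TH exit's labelled shape, verbatim (`Δ·(Λ′^{partnerAges (PEv.step ∘ sh) G′}·
(e^{−credits (credit C g ∘ sh) G′}·e^{lifeCost (padW (dictWT sh R C.n₁) D) (costT sh C K R) G′}))`), **`pshapeTH`** := the
same with PRINT's credits `pcredit O C g ∘ sh` and a REALISED per-step cost `κ` in place of `costT` (the reading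
(ID-a)∕H3 supplies `κ ≤ costT …` on the padded life — displayed by the consumer, not here), `Dominates.rawShapeT_le`,
**`Dominates.pshapeTH_le_shapeTH`**, and **`Dominates.le_prod_shapeTH`**: a class price below a product of
`mult q · pshapeTH … (gen q)` over any finite family of live structures (nonnegative multiplicity factors `mult`, e.g.
the zone∕surcharge factor of rows S6∕S6e) is below the product of `mult q · shapeTH … (gen q)` — the `price`-side
inequality of the socket over the TH exit, whatever multiplicity it carries; §2b the SLACK variant (`C.a + θ ≤ ½γ₀A₁²`,
profile `≥ 1` at birth steps): a class-linear factor `e^{θ·birthLinT sh G}` of the reading is paid by the birth-credit slack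
(`creditsT_slack`, `pshapeTH_mul_exp_le_shapeTH_of_slack`, `le_prod_shapeTH_of_slack`).  §3 sanity (toy pair of
`HistoryConstants`, tags `ε := PEv × ℕ`, `sh := Prod.fst`).

HONEST.  Bookkeeping; discharges nothing of H3 ∕ (ID-a) ∕ (B) ∕ BetaPertH; the surplus∕extension fields of `Dominates`
are not needed on the price side (the TH exit proves its own banking from the flow).  NE7b NOT proved; spine 0∕9.
HONEST DEPENDENCY (cell): continuum YM on T⁴ ⇐ BetaPertH ∧ nine spine estimates (0/9 proved); BetaPertH ⇐ (D1) ∧ (D4)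
∧ CAP+tail; G-an2-4 gates asym, D1 and NE2/3/4.
-/

open Finset
open Literature.MathematicalPhysics.QuantumFieldTheory.Balaban1983to89
open T4PersistenceDictionary T4PersistentHistoryCount T4BankedInduction T4PrintedShapeBanking T4PartnerMultiplicity
open T4TaggedShapeBanking
open Summit.QuantumFields.BalabanUV.T4Continuum.LateMergers

namespace Summit.QuantumFields.BalabanUV.T4Continuum.HistoryConstants

noncomputable section

/-! ## §1 `Dominates` through the shape map -/

section Through

variable {ε : Type*} [DecidableEq ε] {C : T4PrintedShapeBanking.Consts} {O : PrintedO1s} (sh : ε → PEv)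

omit [DecidableEq ε] in
/-- the model's credit of a tagged event is below print's (read through the shape) [folklore] -/
theorem Dominates.creditT_le (hD : Dominates C O) (g : ℕ → ℝ) (e : ε) :
    (credit C g ∘ sh) e ≤ (pcredit O C g ∘ sh) e :=
  hD.credit_le g (sh e)

/-- **THE MODEL'S CREDITS OF A TAGGED GENEALOGY ARE BELOW PRINT'S** (every run). [folklore] -/
theorem Dominates.creditsT_le (hD : Dominates C O) (g : ℕ → ℝ) (G : Gen ε) :
    credits (credit C g ∘ sh) G ≤ credits (pcredit O C g ∘ sh) G :=
  Finset.sum_le_sum fun e _ => hD.credit_le g (sh e)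

omit [DecidableEq ε] in
/-- **PRINT'S FLOOR IS BELOW THE MODEL'S WINDOW FLOOR** of a tagged event on its placed window `[p, p + dictWT sh R n₁ e)`,
at performed steps `n ≤ K` (the first summand of `costT`). [folklore] -/
theorem Dominates.floor_le_wfloorT (hD : Dominates C O) {K : ℕ} (R : ℕ → ℕ) {p n : ℕ} {e : ε}
    (hn : n ∈ Finset.Ico p (p + dictWT sh R C.n₁ e)) (hnK : n ≤ K) :
    O.floor (R n) ≤ wfloor C K R p (sh e) n := by
  rw [wfloor_of_mem hn]
  exact hD.floor_le_floorK R hnK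

omit [DecidableEq ε] in
/-- **LIFE COSTS ARE MONOTONE IN THE PER-STEP COST** on the life, for any label type and ANY window table (in particular
the padded table `padW (dictWT sh R C.n₁) D` of the TH exit). [folklore] -/
theorem lifeCostT_mono {W : ε → ℕ} {κ κ' : Gen ε → ℕ → ℝ} {G : Gen ε} (h : ∀ n ∈ life W G, κ G n ≤ κ' G n) :
    lifeCost W κ G ≤ lifeCost W κ' G :=
  Finset.sum_le_sum h

/-- **RAW TAGGED SHAPE DOMINATION**: print's credits through `sh` and any realised per-step cost read below the model's
`costT` on the life give a raw factor below the model's `e^{−credits (credit ∘ sh)}·e^{+lifeCost W (costT sh)}`.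
[folklore] -/
theorem Dominates.rawShapeT_le (hD : Dominates C O) {K : ℕ} {R : ℕ → ℕ} (g : ℕ → ℝ) {W : ε → ℕ}
    {κ : Gen ε → ℕ → ℝ} {G : Gen ε} (h : ∀ n ∈ life W G, κ G n ≤ costT sh C K R G n) :
    Real.exp (-credits (pcredit O C g ∘ sh) G) * Real.exp (lifeCost W κ G) ≤
      Real.exp (-credits (credit C g ∘ sh) G) * Real.exp (lifeCost W (costT sh C K R) G) :=
  mul_le_mul (Real.exp_le_exp.2 (neg_le_neg (hD.creditsT_le sh g G))) (Real.exp_le_exp.2 (lifeCostT_mono h))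
    (Real.exp_pos _).le (Real.exp_pos _).le

end Through

/-! ## §2 The TH exit's labelled shape, its print-priced counterpart, and the product step -/

section Shape

variable {ε : Type*} [DecidableEq ε] {C : T4PrintedShapeBanking.Consts} {O : PrintedO1s}

/-- **THE TH EXIT'S LABELLED SHAPE** of a tagged genealogy (the right-hand side of the binder `hlabTH` of
`CountThresholdExit.relWeightBound_lateMergers_of_irThreshold`, verbatim, at run `R`, couplings `g`, cutoff `K`, delay `D`):
`Δ·(Λ′^{partnerAges (PEv.step ∘ sh) G}·(e^{−credits (credit C g ∘ sh) G}·e^{lifeCost (padW (dictWT sh R C.n₁) D)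
(costT sh C K R) G}))`. [folklore] -/
def shapeTH (sh : ε → PEv) (C : T4PrintedShapeBanking.Consts) (Δ Λ' : ℝ) (R : ℕ → ℕ) (g : ℕ → ℝ) (K D : ℕ)
    (G : Gen ε) : ℝ :=
  Δ * (Λ' ^ partnerAges (PEv.step ∘ sh) G *
    (Real.exp (-credits (credit C g ∘ sh) G) * Real.exp (lifeCost (padW (dictWT sh R C.n₁) D) (costT sh C K R) G)))

/-- **THE PRINT-PRICED TH SHAPE** with a realised per-step cost `κ`: the same prefactor, PRINT's credits through `sh`,
and `e^{+lifeCost (padW (dictWT sh R C.n₁) D) κ G}`. [folklore] -/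
def pshapeTH (sh : ε → PEv) (O : PrintedO1s) (C : T4PrintedShapeBanking.Consts) (Δ Λ' : ℝ) (R : ℕ → ℕ)
    (g : ℕ → ℝ) (D : ℕ) (κ : Gen ε → ℕ → ℝ) (G : Gen ε) : ℝ :=
  Δ * (Λ' ^ partnerAges (PEv.step ∘ sh) G *
    (Real.exp (-credits (pcredit O C g ∘ sh) G) * Real.exp (lifeCost (padW (dictWT sh R C.n₁) D) κ G)))

variable (sh : ε → PEv)

/-- the print-priced TH shape is nonnegative (`Δ, Λ′ ≥ 0`) [folklore] -/
theorem pshapeTH_nonneg {Δ Λ' : ℝ} (hΔ : 0 ≤ Δ) (hΛ : 0 ≤ Λ') (R : ℕ → ℕ) (g : ℕ → ℝ) (D : ℕ)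
    (κ : Gen ε → ℕ → ℝ) (G : Gen ε) : 0 ≤ pshapeTH sh O C Δ Λ' R g D κ G := by
  unfold pshapeTH; positivity

/-- the TH shape is nonnegative (`Δ, Λ′ ≥ 0`) [folklore] -/
theorem shapeTH_nonneg {Δ Λ' : ℝ} (hΔ : 0 ≤ Δ) (hΛ : 0 ≤ Λ') (R : ℕ → ℕ) (g : ℕ → ℝ) (K D : ℕ) (G : Gen ε) :
    0 ≤ shapeTH sh C Δ Λ' R g K D G := by
  unfold shapeTH; positivity

/-- **PRINT-PRICED TH SHAPE ≤ THE TH EXIT'S SHAPE** under `Dominates`, whenever the realised per-step cost is read below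
the model's `costT` on the padded life. [folklore] -/
theorem Dominates.pshapeTH_le_shapeTH (hD : Dominates C O) {Δ Λ' : ℝ} (hΔ : 0 ≤ Δ) (hΛ : 0 ≤ Λ') (R : ℕ → ℕ)
    (g : ℕ → ℝ) (K D : ℕ) {κ : Gen ε → ℕ → ℝ} {G : Gen ε}
    (h : ∀ n ∈ life (padW (dictWT sh R C.n₁) D) G, κ G n ≤ costT sh C K R G n) :
    pshapeTH sh O C Δ Λ' R g D κ G ≤ shapeTH sh C Δ Λ' R g K D G := by
  unfold pshapeTH shapeTH
  exact mul_le_mul_of_nonneg_left (mul_le_mul_of_nonneg_left (hD.rawShapeT_le sh g h) (pow_nonneg hΛ _)) hΔ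

/-- **THE PRODUCT STEP** (the `price`∕`price′` side of the socket over the TH exit): a class price below a product of
`mult q · pshapeTH … (gen q)` over any finite family of live structures — nonnegative multiplicity factors `mult`, each
realised cost read below the model's `costT` — is below the product of `mult q · shapeTH … (gen q)`. [folklore] -/
theorem Dominates.le_prod_shapeTH (hD : Dominates C O) {Δ Λ' : ℝ} (hΔ : 0 ≤ Δ) (hΛ : 0 ≤ Λ') (R : ℕ → ℕ)
    (g : ℕ → ℝ) (K D : ℕ) {ι : Type*} (S : Finset ι) (gen : ι → Gen ε) {mult : ι → ℝ}
    (hmult : ∀ q ∈ S, 0 ≤ mult q) (κ : ι → Gen ε → ℕ → ℝ)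
    (h : ∀ q ∈ S, ∀ n ∈ life (padW (dictWT sh R C.n₁) D) (gen q), κ q (gen q) n ≤ costT sh C K R (gen q) n)
    {x : ℝ} (hx : x ≤ ∏ q ∈ S, mult q * pshapeTH sh O C Δ Λ' R g D (κ q) (gen q)) :
    x ≤ ∏ q ∈ S, mult q * shapeTH sh C Δ Λ' R g K D (gen q) :=
  hx.trans (prod_le_prod (fun q hq => mul_nonneg (hmult q hq) (pshapeTH_nonneg sh hΔ hΛ R g D _ _))
    fun q hq => mul_le_mul_of_nonneg_left (hD.pshapeTH_le_shapeTH sh hΔ hΛ R g K D (h q hq)) (hmult q hq))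

/-! ### §2b The slack variant: a class-linear factor `e^{θ·Σ_{births}(d′+1)}` is paid by the birth-credit slack

The reading's per-birth class-linear factors (admissible-sequence ∕ lattice-animal entropy «exp O(1)(MR_j)^{−d}|Z_j|»
p. 383, `E_f` per unit of `d′+1` in `T4PersistentHistoryCount.birthCredit_dominates`) ride on the displayed H3 bound as
`e^{θ·birthLinT sh G}`; they are absorbed when the junction is taken with SLACK `C.a + θ ≤ ½γ₀A₁²` and the profile is at
least `1` at the birth steps (the exit's `hx1` gives `log g⁻² ≥ 1`, hence `p₀(g) ≥ A₀`; `A₀ ≥ 1` or a rescaled `θ` is the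
consumer's display).  (Cross-read INFO I1 on the bridge, cell journal 2026-08-20.) -/

/-- **THE CLASS-LINEAR CONTENT THROUGH THE SHAPE**: `Σ_{e ∈ events, (sh e) a birth} ((sh e).fat + 1)`. [folklore] -/
def birthLinT (sh : ε → PEv) (G : Gen ε) : ℝ :=
  ∑ e ∈ G.events with (sh e).kind = 0, (((sh e).fat : ℝ) + 1)

/-- **CREDIT SLACK**: with `C.a + θ ≤ ½γ₀A₁²`, `θ ≥ 0` and profile `≥ 1` at the genealogy's birth steps, print's credits
exceed the model's by at least `θ·birthLinT`. [folklore] -/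
theorem creditsT_slack {θ : ℝ} (hθ : 0 ≤ θ) (hslack : C.a + θ ≤ O.γ₀ * O.A₁ ^ 2 / 2) (g : ℕ → ℝ) {G : Gen ε}
    (hP : ∀ e ∈ G.events, (sh e).kind = 0 → 1 ≤ p0Profile C.A₀ C.p₀ (g (sh e).step)) :
    credits (credit C g ∘ sh) G + θ * birthLinT sh G ≤ credits (pcredit O C g ∘ sh) G := by
  unfold credits birthLinT
  rw [Finset.sum_filter, Finset.mul_sum, ← Finset.sum_add_distrib]
  refine Finset.sum_le_sum fun e he => ?_
  simp only [Function.comp_apply]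
  by_cases h0 : (sh e).kind = 0
  · rw [if_pos h0, credit_kind0 h0, pcredit_kind0 h0]
    have h1 : 1 ≤ p0Profile C.A₀ C.p₀ (g (sh e).step) := hP e he h0
    have hsq : 1 ≤ p0Profile C.A₀ C.p₀ (g (sh e).step) ^ 2 := by nlinarith
    have hf : (0 : ℝ) ≤ ((sh e).fat : ℝ) + 1 := by positivity
    nlinarith [mul_le_mul_of_nonneg_right hsq (mul_nonneg hθ hf),
      mul_le_mul_of_nonneg_right hslack (mul_nonneg (sq_nonneg (p0Profile C.A₀ C.p₀ (g (sh e).step))) hf)]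
  · rw [if_neg h0, mul_zero, add_zero]
    by_cases h1 : (sh e).kind = 1
    · rw [credit_kind1 h1, pcredit_kind1 h1]
    · have h2 : (sh e).kind = 2 := by
        generalize hk : (sh e).kind = k at h0 h1 ⊢
        fin_cases k <;> simp_all
      rw [credit_kind2 h2, pcredit_kind2 h2]

/-- **PRINT-PRICED TH SHAPE × CLASS-LINEAR FACTOR ≤ THE TH EXIT'S SHAPE** under the slack junction `C.a + θ ≤ ½γ₀A₁²`
(which contains the field `Dominates.birth`; the cost fields of `Dominates` serve the consumer's reading `κ ≤ costT`
through the entry lemmas of §1), profile `≥ 1` at birth steps, realised cost read below `costT`. [folklore] -/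
theorem pshapeTH_mul_exp_le_shapeTH_of_slack {θ : ℝ} (hθ : 0 ≤ θ)
    (hslack : C.a + θ ≤ O.γ₀ * O.A₁ ^ 2 / 2) {Δ Λ' : ℝ} (hΔ : 0 ≤ Δ) (hΛ : 0 ≤ Λ') (R : ℕ → ℕ) (g : ℕ → ℝ)
    (K D : ℕ) {κ : Gen ε → ℕ → ℝ} {G : Gen ε}
    (hP : ∀ e ∈ G.events, (sh e).kind = 0 → 1 ≤ p0Profile C.A₀ C.p₀ (g (sh e).step))
    (h : ∀ n ∈ life (padW (dictWT sh R C.n₁) D) G, κ G n ≤ costT sh C K R G n) :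
    pshapeTH sh O C Δ Λ' R g D κ G * Real.exp (θ * birthLinT sh G) ≤ shapeTH sh C Δ Λ' R g K D G := by
  unfold pshapeTH shapeTH
  have hc : Real.exp (-credits (pcredit O C g ∘ sh) G) * Real.exp (θ * birthLinT sh G) ≤
      Real.exp (-credits (credit C g ∘ sh) G) := by
    rw [← Real.exp_add]
    exact Real.exp_le_exp.2 (by linarith [creditsT_slack sh hθ hslack g hP])
  have hl : Real.exp (lifeCost (padW (dictWT sh R C.n₁) D) κ G) ≤
      Real.exp (lifeCost (padW (dictWT sh R C.n₁) D) (costT sh C K R) G) :=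
    Real.exp_le_exp.2 (lifeCostT_mono h)
  have hraw : Real.exp (-credits (pcredit O C g ∘ sh) G) * Real.exp (lifeCost (padW (dictWT sh R C.n₁) D) κ G) *
      Real.exp (θ * birthLinT sh G) ≤ Real.exp (-credits (credit C g ∘ sh) G) *
        Real.exp (lifeCost (padW (dictWT sh R C.n₁) D) (costT sh C K R) G) := by
    calc _ = Real.exp (-credits (pcredit O C g ∘ sh) G) * Real.exp (θ * birthLinT sh G) *
          Real.exp (lifeCost (padW (dictWT sh R C.n₁) D) κ G) := by ring
      _ ≤ _ := mul_le_mul hc hl (Real.exp_pos _).le (Real.exp_pos _).le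
  have hpre : 0 ≤ Δ * Λ' ^ partnerAges (PEv.step ∘ sh) G := mul_nonneg hΔ (pow_nonneg hΛ _)
  calc _ = Δ * Λ' ^ partnerAges (PEv.step ∘ sh) G * (Real.exp (-credits (pcredit O C g ∘ sh) G) *
        Real.exp (lifeCost (padW (dictWT sh R C.n₁) D) κ G) * Real.exp (θ * birthLinT sh G)) := by ring
    _ ≤ Δ * Λ' ^ partnerAges (PEv.step ∘ sh) G * (Real.exp (-credits (credit C g ∘ sh) G) *
        Real.exp (lifeCost (padW (dictWT sh R C.n₁) D) (costT sh C K R) G)) :=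
      mul_le_mul_of_nonneg_left hraw hpre
    _ = _ := by ring

/-- **THE PRODUCT STEP, SLACK VARIANT**: a class price below `∏ mult q · pshapeTH … (gen q) · e^{θ·birthLinT (gen q)}` is
below `∏ mult q · shapeTH … (gen q)`. [folklore] -/
theorem le_prod_shapeTH_of_slack {θ : ℝ} (hθ : 0 ≤ θ)
    (hslack : C.a + θ ≤ O.γ₀ * O.A₁ ^ 2 / 2) {Δ Λ' : ℝ} (hΔ : 0 ≤ Δ) (hΛ : 0 ≤ Λ') (R : ℕ → ℕ) (g : ℕ → ℝ)
    (K D : ℕ) {ι : Type*} (S : Finset ι) (gen : ι → Gen ε) {mult : ι → ℝ} (hmult : ∀ q ∈ S, 0 ≤ mult q)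
    (κ : ι → Gen ε → ℕ → ℝ)
    (hP : ∀ q ∈ S, ∀ e ∈ (gen q).events, (sh e).kind = 0 → 1 ≤ p0Profile C.A₀ C.p₀ (g (sh e).step))
    (h : ∀ q ∈ S, ∀ n ∈ life (padW (dictWT sh R C.n₁) D) (gen q), κ q (gen q) n ≤ costT sh C K R (gen q) n)
    {x : ℝ} (hx : x ≤ ∏ q ∈ S, mult q * (pshapeTH sh O C Δ Λ' R g D (κ q) (gen q) *
      Real.exp (θ * birthLinT sh (gen q)))) :
    x ≤ ∏ q ∈ S, mult q * shapeTH sh C Δ Λ' R g K D (gen q) :=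
  hx.trans (prod_le_prod
    (fun q hq => mul_nonneg (hmult q hq) (mul_nonneg (pshapeTH_nonneg sh hΔ hΛ R g D _ _) (Real.exp_pos _).le))
    fun q hq => mul_le_mul_of_nonneg_left
      (pshapeTH_mul_exp_le_shapeTH_of_slack sh hθ hslack hΔ hΛ R g K D (hP q hq) (h q hq)) (hmult q hq))

/-- at delay `D = 0` the padded table is the tagged table itself (`padW_zero`): the shape of the assembly's target
(`D := 0`, `Δ := 1`, ruling R-OWNER-22-1). [folklore] -/
theorem shapeTH_zero_one (R : ℕ → ℕ) (g : ℕ → ℝ) (K : ℕ) (Λ' : ℝ) (G : Gen ε) :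
    shapeTH sh C 1 Λ' R g K 0 G = Λ' ^ partnerAges (PEv.step ∘ sh) G *
      (Real.exp (-credits (credit C g ∘ sh) G) * Real.exp (lifeCost (dictWT sh R C.n₁) (costT sh C K R) G)) := by
  rw [shapeTH, padW_zero, one_mul]

end Shape

/-! ## §3 Sanity: the toy pair of `HistoryConstants`, tags `PEv × ℕ`, shape `Prod.fst` -/

namespace Sanity

/-- a tagged unit region born at step `0` with tag `7` [folklore] -/
def Gt : Gen (PEv × ℕ) := Gen.born (((0, 0, 1) : PEv), 7) 0

/-- on the toy pair, the print-priced TH shape of `Gt` with the model's own cost as realised cost is below the TH shape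
(the credit side of `Dominates` at work; `D = 0`, `Δ = 1`, `Λ′ = 2`, `R ≡ 2`, `g ≡ 1∕2`, `K = 3`). [folklore] -/
example : pshapeTH Prod.fst O₁ C₁ 1 2 (fun _ => 2) (fun _ => 1 / 2) 0 (costT Prod.fst C₁ 3 fun _ => 2) Gt ≤
    shapeTH Prod.fst C₁ 1 2 (fun _ => 2) (fun _ => 1 / 2) 3 0 Gt :=
  dominates_C₁_O₁.pshapeTH_le_shapeTH Prod.fst zero_le_one zero_le_two _ _ 3 0 fun _ _ => le_rfl

end Sanity

end

end Summit.QuantumFields.BalabanUV.T4Continuum.HistoryConstants
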